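import Literature.NumberTheory.GaloisCohomology.Howard2004.TransverseComplementOfCyclicProofs
import Literature.NumberTheory.GaloisCohomology.Howard2004.InertRingClassTotallyRamifiedProofs
import Literature.NumberTheory.EllipticCurves.RingClassGalOverCyclicProofs
import Mathlib.Data.ZMod.QuotientGroup
import Mathlib.GroupTheory.SpecificGroups.Cyclic
import HarnessLib

/-!
# At an inert `λ = (ℓ)` of an imaginary quadratic `K`, a TAME GENERATOR of `I_{K_λ}` generates `Gal(K[ℓ]_λ/K_λ)`:
# the hypotheses `hcyc`/`hkill` of `TransverseComplementOfCyclicProofs`, and Howard's `H¹ = H¹_f ⊕ H¹_tr` (proofs file)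

Topic `NumberTheory/GaloisCohomology/Howard2004` (sequel to `InertRingClassTotallyRamifiedProofs` (`Γ_{K_λ} = I·Λ`,
`Λ = Γ_{K_λ} ∩ Γ_{K[ℓ]}`) and `TransverseComplementOfCyclicProofs` (the complement from `hcyc`/`hkill`)).
THEOREMS ONLY: no definition, no named fact, no instance, no `sorry`.

B. Howard, Compositio Math. 140 (2004) §1.2 (arXiv:1202.6340 p. 6 L84–95): `K[ℓ]_λ/K_λ` is «totally TAMELY
ramified»; Gross 1991 §3: `Gal(K[ℓ]/K[1]) = G_ℓ ≃ F_λ^×/F_ℓ^×` is cyclic (tree `RingClassGalOverCyclic`).  So the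
action of the inertia group `I_{K_λ}` on `K[ℓ]` factors through a cyclic quotient whose exponent divides
`q_λ − 1` (here a HYPOTHESIS `hGexp`: every element of `G_ℓ` has order dividing `q_λ − 1`; classically
`#G_ℓ = (ℓ+1)/u_K ∣ ℓ² − 1`), hence through the tame character of level `q_λ − 1`, on which a tame generator `σ₀`
is a generator (tree `IsTameGenerator.apply_eq_zero`).

* `exists_pow_inv_mul_mem_and_card_dvd_of_isTameGenerator` — the homomorphism `I_{K_λ} → G_ℓ` is generated by
  the image of a tame generator `σ₀` (given `hGexp`): both clauses below at once.
* **`exists_pow_inv_mul_mem_localRingClassSubgroup_of_isTameGenerator`** — `hcyc`: every `σ ∈ Γ_{K_λ}` lies in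
  `σ₀^j · (Γ_{K_λ} ∩ Γ_{K[ℓ]})` for some `j`, `σ₀` a tame generator (given `hGexp`).
* **`natCard_ringClassGalOver_dvd_of_pow_mem`** — `hkill`'s source: if `σ₀^d ∈ Γ_{K[ℓ]}` then `#G_ℓ ∣ d`.
* **`isCompl_unramifiedSubgroup_transverseCondition_of_isImaginaryQuadratic`** — HOWARD PROP. 1.1.9,
  `H¹(K_λ, T) = H¹_f ⊕ H¹_tr`, for a finite `p`-primary `T` with trivial `Γ_{K_λ}`-action, `(q_λ − 1)·T = 0` and
  `#G_ℓ · T = 0`, at an inert `λ` of an imaginary quadratic `K`, given `hGexp`.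
Cell `pub/bsd-print-x9`, G87 (print leaf `stub_h161` of stmt-BirchSwinnertonDyer-22642); seat `bsd-line-x9-p1-w3` g14,
brick (SPLIT-GEN).  BSD is not proved by any of this.

References: [Howard2004HeegnerKolyvagin] Prop. 1.1.9, §1.2; [GrossLMS1991] §3; [SerreInventiones1972] §1.3.
-/

set_option autoImplicit false

noncomputable section

open scoped Classical NumberField Pointwise
open NumberField IsDedekindDomain IsDedekindDomain.HeightOneSpectrum Field Topology

namespace Literature.NumberTheory.GaloisCohomology.Howard2004

open Literature.NumberTheory.GaloisRepresentations
open Literature.NumberTheory.GaloisRepresentations.IsNonarchimedeanLocalField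
open Literature.NumberTheory.EllipticCurves

variable {K : Type} [Field K] [NumberField K]

/-- **The action of `I_{K_λ}` on `K[ℓ]` as a homomorphism to `G_ℓ = Gal(K[ℓ]/K[1])`, generated by a tame
generator.**  For `K` imaginary quadratic, `(ℓ)` inert, `λ ∋ ℓ`, a class-field copy `R ≅ K[ℓ]` in `K̄` with
`emb : K[ℓ] → K̄`, and a tame generator `σ₀` of `I_{K_λ}`: assuming every element of
`G_ℓ = ringClassGalOver ι (ℓ·1) 1` has order dividing `q_λ − 1` (`hGexp`), every `τ ∈ I_{K_λ}` satisfies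
`(σ₀^j)⁻¹ τ ∈ Γ_{K_λ} ∩ Γ_{K[ℓ]}` for some `j`, and `σ₀^d ∈ Γ_{K_λ} ∩ Γ_{K[ℓ]}` forces `#G_ℓ ∣ d`.
[cite: GrossLMS1991, §3 (G_ℓ cyclic; proof of Prop. 3.7 (2))] [cite: SerreInventiones1972, §1.3 Prop. 2]
[cite: Howard2004HeegnerKolyvagin, §1.2 (arXiv:1202.6340 p. 6 L84–95)] -/
theorem exists_pow_inv_mul_mem_and_card_dvd_of_isTameGenerator (hK : IsImaginaryQuadratic K)
    (jbar : AlgebraicClosure K →+* ℂ) {ℓ : ℕ} (hℓ : ℓ.Prime) (hℓP : (Ideal.span {(ℓ : 𝓞 K)}).IsPrime)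
    {v : HeightOneSpectrum (𝓞 K)} (hv : (ℓ : 𝓞 K) ∈ v.asIdeal) {σ₀ : absInertia (v.adicCompletion K)}
    (hσ₀ : IsTameGenerator σ₀)
    (hGexp : ∀ g ∈ ringClassGalOver (jbar.comp (algebraMap K (AlgebraicClosure K))) (ℓ * 1) 1,
      g ^ (residueFieldCard (v.adicCompletion K) - 1) = 1) :
    (∀ τ : absInertia (v.adicCompletion K), ∃ j : ℕ,
      ((σ₀ : absoluteGaloisGroup (v.adicCompletion K)) ^ j)⁻¹ * τ ∈ localRingClassSubgroup ℓ jbar v) ∧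
    ∀ d : ℕ, (σ₀ : absoluteGaloisGroup (v.adicCompletion K)) ^ d ∈ localRingClassSubgroup ℓ jbar v →
      Nat.card (ringClassGalOver (jbar.comp (algebraMap K (AlgebraicClosure K))) (ℓ * 1) 1) ∣ d := by
  set ι : K →+* ℂ := jbar.comp (algebraMap K (AlgebraicClosure K))
  have hℓ1 : ℓ * 1 ≠ 0 := by rw [mul_one]; exact hℓ.ne_zero
  obtain ⟨R, hfd, hgal, -, -, ⟨e⟩⟩ := exists_classField_algEquiv_ringClassField hK ι hℓ1
  haveI := hfd
  haveI := hgal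
  set emb : ringClassField K ι (ℓ * 1) →+* AlgebraicClosure K :=
    (R.val : R →ₐ[K] AlgebraicClosure K).toRingHom.comp e.symm.toAlgHom.toRingHom
  have hemb_apply : ∀ x, emb x = ((e.symm x : R) : AlgebraicClosure K) := fun _ => rfl
  have hemb : ∀ k : K, emb (algebraMap K (ringClassField K ι (ℓ * 1)) k) =
      algebraMap K (AlgebraicClosure K) k := fun k => by
    rw [hemb_apply, AlgEquiv.commutes]; rfl
  have h𝔓₀ := adicCompletionPrime_mem_primesAbove K v
  set res := absGaloisRestrict K (v.adicCompletion K)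
  set G := ringClassGalOver ι (ℓ * 1) 1
  set N := localRingClassSubgroup ℓ jbar v
  -- local inertia restricts into `I_{𝔓₀}`
  have hIres : ∀ τ : absInertia (v.adicCompletion K),
      res τ ∈ (adicCompletionPrime K v).inertia (absoluteGaloisGroup K) := fun τ => by
    rw [inertia_adicCompletionPrime_eq_map_absInertia]
    exact Subgroup.mem_map_of_mem _ τ.2
  -- membership in `N` ↔ fixing `emb(K[ℓ])` pointwise
  have hNiff : ∀ g : absoluteGaloisGroup (v.adicCompletion K),
      g ∈ N ↔ ∀ x, (show AlgebraicClosure K ≃ₐ[K] AlgebraicClosure K from res g) (emb x) = emb x := by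
    intro g
    change res g ∈ ringClassSubgroup K ℓ jbar ↔ _
    have key : res g ∈ ringClassSubgroup K (ℓ * 1) jbar ↔ ∀ x,
        (show AlgebraicClosure K ≃ₐ[K] AlgebraicClosure K from res g) (emb x) = emb x := by
      rw [mem_ringClassSubgroup_iff_forall_smul_eq hK jbar hℓ1 e]
      constructor
      · intro h x
        have := h (emb x) (by rw [hemb_apply]; exact (e.symm x).2)
        rwa [Field.absoluteGaloisGroup.smul_def] at this
      · intro h y hy
        have hyx : emb (e ⟨y, hy⟩) = y := by rw [hemb_apply, AlgEquiv.symm_apply_apply]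
        rw [Field.absoluteGaloisGroup.smul_def, ← hyx]
        exact h _
    simpa only [mul_one] using key
  -- the homomorphism `χ : I → G`
  have hex : ∀ τ : absInertia (v.adicCompletion K), ∃ σ ∈ G, ∀ x : ringClassField K ι (ℓ * 1),
      (show AlgebraicClosure K ≃ₐ[K] AlgebraicClosure K from res τ) (emb x) = emb (σ x) := fun τ =>
    exists_mem_ringClassGalOver_apply_emb_eq_of_mem_inertia hK ι hℓ one_ne_zero hℓ.not_dvd_one hv hℓP emb
      hemb h𝔓₀ (hIres τ)
  choose σf hσG hσf using hex
  have huniq : ∀ σ σ' : ringClassField K ι (ℓ * 1) ≃ₐ[ℚ] ringClassField K ι (ℓ * 1),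
      (∀ x, emb (σ x) = emb (σ' x)) → σ = σ' := fun σ σ' h =>
    AlgEquiv.ext fun x => emb.injective (h x)
  -- every element of `G_ℓ` lifts to the local inertia group
  have hsrc : ∀ g ∈ G, ∃ τ : absInertia (v.adicCompletion K), ∀ x : ringClassField K ι (ℓ * 1),
      (show AlgebraicClosure K ≃ₐ[K] AlgebraicClosure K from res τ) (emb x) = emb (g x) := by
    intro g hg
    obtain ⟨τ', hτ'I, hτ'⟩ := exists_mem_inertia_apply_emb_eq_of_mem_ringClassGalOver hK ι hℓ one_ne_zero
      hℓ.not_dvd_one hv hℓP emb hemb h𝔓₀ hg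
    rw [inertia_adicCompletionPrime_eq_map_absInertia] at hτ'I
    obtain ⟨τ, hτ, hττ'⟩ := Subgroup.mem_map.1 hτ'I
    refine ⟨⟨τ, hτ⟩, fun x => ?_⟩
    rw [← hτ' x]
    exact congrArg (fun γ => (show AlgebraicClosure K ≃ₐ[K] AlgebraicClosure K from γ) (emb x)) hττ'
  -- `G` is cyclic (Gross §3)
  haveI hcycG : IsCyclic G :=
    RingClassGalOverCyclic.isCyclic_ringClassGalOver hK ι one_ne_zero hℓ hℓ.not_dvd_one hℓP
  -- from here on `G` is opaque (keeps instance unification on `↥G` cheap)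
  clear_value G
  let χ : absInertia (v.adicCompletion K) →* G :=
    MonoidHom.mk' (fun τ => ⟨σf τ, hσG τ⟩) fun τ τ' => by
      apply Subtype.ext
      change σf (τ * τ') = σf τ * σf τ'
      refine huniq _ _ fun x => ?_
      rw [← hσf, AlgEquiv.mul_apply, ← hσf, ← hσf, Subgroup.coe_mul, map_mul]
      rfl
  have hχ : ∀ (τ : absInertia (v.adicCompletion K)) (x : ringClassField K ι (ℓ * 1)),
      (show AlgebraicClosure K ≃ₐ[K] AlgebraicClosure K from res (τ : absoluteGaloisGroup _)) (emb x) =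
        emb ((χ τ : ringClassField K ι (ℓ * 1) ≃ₐ[ℚ] ringClassField K ι (ℓ * 1)) x) :=
    fun τ x => hσf τ x
  -- kernel of `χ` = `I ∩ N`
  have hker : ∀ τ : absInertia (v.adicCompletion K), χ τ = 1 ↔ (τ : absoluteGaloisGroup _) ∈ N := by
    intro τ
    rw [hNiff]
    constructor
    · intro h x
      rw [hχ, h]; rfl
    · intro h
      apply Subtype.ext
      change σf τ = 1
      exact huniq _ _ fun x => by rw [← hσf, h x]; rfl
  -- `χ` is surjective (every element of `G_ℓ` lifts to inertia)
  have hsurj : Function.Surjective χ := by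
    rintro ⟨g, hg⟩
    obtain ⟨τ, hτ⟩ := hsrc g hg
    refine ⟨τ, Subtype.ext (huniq _ _ fun x => ?_)⟩
    change emb (σf τ x) = emb (g x)
    rw [← hσf, hτ x]
  -- transport `G` to `ZMod n` (an additive commutative group), `n = #G`
  let eZ : Multiplicative (ZMod (Nat.card G)) ≃* G := zmodCyclicMulEquiv hcycG
  let dlog : G →* Multiplicative (ZMod (Nat.card G)) := eZ.symm.toMonoidHom
  have hdlog_inj : Function.Injective dlog := eZ.symm.injective
  -- the additive target: `ZMod n` modulo the multiples of `dlog (χ σ₀)`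
  set a₀ : ZMod (Nat.card G) := Multiplicative.toAdd (dlog (χ σ₀)) with ha₀_def
  let A := ZMod (Nat.card G) ⧸ AddSubgroup.zmultiples a₀
  letI : TopologicalSpace A := ⊥
  haveI : DiscreteTopology A := ⟨rfl⟩
  let f : absInertia (v.adicCompletion K) → A := fun τ =>
    QuotientAddGroup.mk (Multiplicative.toAdd (dlog (χ τ)))
  have hf_apply : ∀ τ, f τ = QuotientAddGroup.mk (Multiplicative.toAdd (dlog (χ τ))) := fun _ => rfl
  -- `f` is continuous: constant on the cosets of the open `I ∩ N`
  have hNopen : IsOpen (N : Set (absoluteGaloisGroup (v.adicCompletion K))) :=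
    isOpen_localRingClassSubgroup hK jbar hℓ.ne_zero v
  have hfcont : Continuous f := by
    refine (IsLocallyConstant.iff_exists_open f).2 (fun τ => ?_) |>.continuous
    refine ⟨Subtype.val ⁻¹' ((fun g => (τ : absoluteGaloisGroup (v.adicCompletion K))⁻¹ * g) ⁻¹'
        (N : Set (absoluteGaloisGroup (v.adicCompletion K)))),
      (hNopen.preimage (continuous_const_mul _)).preimage continuous_subtype_val, ?_, fun τ' hτ' => ?_⟩
    · show (τ : absoluteGaloisGroup (v.adicCompletion K))⁻¹ * τ ∈ (N : Set _)
      rw [inv_mul_cancel]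
      exact N.one_mem
    · have hmem : ((τ⁻¹ * τ' : absInertia (v.adicCompletion K)) :
          absoluteGaloisGroup (v.adicCompletion K)) ∈ N := by
        rw [Subgroup.coe_mul, Subgroup.coe_inv]
        exact hτ'
      have h1 : χ (τ⁻¹ * τ') = 1 := (hker _).2 hmem
      have h2 : χ τ' = χ τ :=
        calc χ τ' = χ (τ * (τ⁻¹ * τ')) := by rw [mul_inv_cancel_left]
          _ = χ τ := by rw [map_mul, h1, mul_one (χ τ)]  -- NB: a bare `mul_one` would hit `ℓ * 1`
      rw [hf_apply, hf_apply, h2]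
  have hfmul : ∀ a b, f (a * b) = f a + f b := fun a b => by
    rw [hf_apply, hf_apply, hf_apply, map_mul, map_mul, toAdd_mul, QuotientAddGroup.mk_add]
  have hpow1 : ∀ τ, (χ τ) ^ (residueFieldCard (v.adicCompletion K) - 1) = 1 := fun τ =>
    Subtype.ext (by rw [Subgroup.coe_pow, Subgroup.coe_one]; exact hGexp _ (χ τ).2)
  have hfd : ∀ τ, (residueFieldCard (v.adicCompletion K) - 1) • f τ = 0 := fun τ => by
    rw [hf_apply, ← QuotientAddGroup.mk_nsmul, ← toAdd_pow, ← map_pow, hpow1, map_one, toAdd_one,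
      QuotientAddGroup.mk_zero]
  have hf0 : f σ₀ = 0 := by
    rw [hf_apply, ← ha₀_def, (QuotientAddGroup.eq_zero_iff _).2 (AddSubgroup.mem_zmultiples a₀)]
  have hfzero := hσ₀.apply_eq_zero f hfcont hfmul hfd hf0
  -- hence `χ τ ∈ ⟨χ σ₀⟩` for every `τ`
  have hmemC : ∀ τ, χ τ ∈ Subgroup.zpowers (χ σ₀) := fun τ => by
    have h := hfzero τ
    rw [hf_apply, QuotientAddGroup.eq_zero_iff, AddSubgroup.mem_zmultiples_iff] at h
    obtain ⟨k, hk⟩ := h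
    refine Subgroup.mem_zpowers_iff.2 ⟨k, hdlog_inj ?_⟩
    apply Multiplicative.toAdd.injective
    rw [map_zpow, toAdd_zpow, ← hk, ha₀_def]
  have hfin : IsOfFinOrder (χ σ₀) :=
    isOfFinOrder_iff_pow_eq_one.2 ⟨residueFieldCard (v.adicCompletion K) - 1,
      Nat.sub_pos_of_lt (one_lt_residueFieldCard (v.adicCompletion K)), hpow1 σ₀⟩
  refine ⟨fun τ => ?_, fun d hd => ?_⟩
  · -- `χ τ = (χ σ₀)^j`, so `(σ₀^j)⁻¹ τ ∈ N`
    obtain ⟨j, hj⟩ := (Submonoid.mem_powers_iff _ _).1 ((hfin.mem_powers_iff_mem_zpowers).2 (hmemC τ))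
    refine ⟨j, ?_⟩
    have h1 : χ ((σ₀ ^ j)⁻¹ * τ) = 1 := by rw [map_mul, map_inv, map_pow, hj, inv_mul_cancel]
    have h2 := (hker _).1 h1
    rwa [Subgroup.coe_mul, Subgroup.coe_inv, Subgroup.coe_pow] at h2
  · -- `σ₀^d ∈ N ⇒ (χ σ₀)^d = 1 ⇒ #G = orderOf (χ σ₀) ∣ d`
    have h1 : (χ σ₀) ^ d = 1 := by
      rw [← map_pow]
      exact (hker _).2 (by rw [Subgroup.coe_pow]; exact hd)
    have hgen : Subgroup.zpowers (χ σ₀) = ⊤ := by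
      rw [eq_top_iff]
      rintro g -
      obtain ⟨τ, rfl⟩ := hsurj g
      exact hmemC τ
    have hcard : Nat.card G = orderOf (χ σ₀) := by
      rw [← Nat.card_zpowers, hgen, Subgroup.card_top]
    rw [hcard]
    exact orderOf_dvd_of_pow_eq_one h1

/-- **`hcyc` at an inert prime: a tame generator generates `Γ_{K_λ}` modulo `Γ_{K_λ} ∩ Γ_{K[ℓ]}`.**  Under the
hypotheses of `exists_pow_inv_mul_mem_and_card_dvd_of_isTameGenerator`, EVERY `σ ∈ Γ_{K_λ}` (not only an
element of inertia) lies in `σ₀^j · (Γ_{K_λ} ∩ Γ_{K[ℓ]})` for some `j : ℕ` — because `Γ_{K_λ} = I_{K_λ} · (Γ_{K_λ} ∩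
Γ_{K[ℓ]})` (`exists_mem_absInertia_inv_mul_mem_localRingClassSubgroup`, «`K[ℓ]_λ/K_λ` totally ramified»).  This is
the hypothesis `hcyc` of `isCompl_unramifiedSubgroup_transverseCondition_of_cyclic` (and of the isotropy lemmas
of the transverse condition) with `Λ = localRingClassSubgroup ℓ jbar v`.
[cite: Howard2004HeegnerKolyvagin, §1.2 (arXiv:1202.6340 p. 6 L84–95)] [cite: GrossLMS1991, §3] -/
theorem exists_pow_inv_mul_mem_localRingClassSubgroup_of_isTameGenerator (hK : IsImaginaryQuadratic K)
    (jbar : AlgebraicClosure K →+* ℂ) {ℓ : ℕ} (hℓ : ℓ.Prime) (hℓP : (Ideal.span {(ℓ : 𝓞 K)}).IsPrime)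
    {v : HeightOneSpectrum (𝓞 K)} (hv : (ℓ : 𝓞 K) ∈ v.asIdeal) {σ₀ : absInertia (v.adicCompletion K)}
    (hσ₀ : IsTameGenerator σ₀)
    (hGexp : ∀ g ∈ ringClassGalOver (jbar.comp (algebraMap K (AlgebraicClosure K))) (ℓ * 1) 1,
      g ^ (residueFieldCard (v.adicCompletion K) - 1) = 1)
    (σ : absoluteGaloisGroup (v.adicCompletion K)) :
    ∃ j : ℕ, ((σ₀ : absoluteGaloisGroup (v.adicCompletion K)) ^ j)⁻¹ * σ ∈ localRingClassSubgroup ℓ jbar v := by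
  obtain ⟨τ, hτ, hn⟩ := exists_mem_absInertia_inv_mul_mem_localRingClassSubgroup hK jbar hℓ hℓP hv σ
  obtain ⟨j, hj⟩ :=
    (exists_pow_inv_mul_mem_and_card_dvd_of_isTameGenerator hK jbar hℓ hℓP hv hσ₀ hGexp).1 ⟨τ, hτ⟩
  refine ⟨j, ?_⟩
  have h := (localRingClassSubgroup ℓ jbar v).mul_mem hj hn
  rwa [mul_assoc, mul_inv_cancel_left] at h

/-- **`hkill`'s source: `σ₀^d ∈ Γ_{K_λ} ∩ Γ_{K[ℓ]}` forces `#G_ℓ ∣ d`** (`G_ℓ = ringClassGalOver ι (ℓ·1) 1`,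
`σ₀` a tame generator of `I_{K_λ}`, `(ℓ)` inert in the imaginary quadratic `K`, `λ ∋ ℓ`, given `hGexp`): the image
of `σ₀` generates the cyclic group `G_ℓ`, so its order is `#G_ℓ`.  Hence a module killed by `#G_ℓ` is killed by
every such `d` (the hypothesis `hkill` of `isCompl_unramifiedSubgroup_transverseCondition_of_cyclic`).
[cite: GrossLMS1991, §3] [cite: Howard2004HeegnerKolyvagin, §1.2 (arXiv:1202.6340 p. 6 L84–95)] -/
theorem natCard_ringClassGalOver_dvd_of_pow_mem (hK : IsImaginaryQuadratic K)
    (jbar : AlgebraicClosure K →+* ℂ) {ℓ : ℕ} (hℓ : ℓ.Prime) (hℓP : (Ideal.span {(ℓ : 𝓞 K)}).IsPrime)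
    {v : HeightOneSpectrum (𝓞 K)} (hv : (ℓ : 𝓞 K) ∈ v.asIdeal) {σ₀ : absInertia (v.adicCompletion K)}
    (hσ₀ : IsTameGenerator σ₀)
    (hGexp : ∀ g ∈ ringClassGalOver (jbar.comp (algebraMap K (AlgebraicClosure K))) (ℓ * 1) 1,
      g ^ (residueFieldCard (v.adicCompletion K) - 1) = 1)
    {d : ℕ} (hd : (σ₀ : absoluteGaloisGroup (v.adicCompletion K)) ^ d ∈ localRingClassSubgroup ℓ jbar v) :
    Nat.card (ringClassGalOver (jbar.comp (algebraMap K (AlgebraicClosure K))) (ℓ * 1) 1) ∣ d :=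
  (exists_pow_inv_mul_mem_and_card_dvd_of_isTameGenerator hK jbar hℓ hℓP hv hσ₀ hGexp).2 d hd

/-- **Howard Prop. 1.1.9 at an inert prime, `H¹(K_λ, T) = H¹_f ⊕ H¹_tr`**: for `K` imaginary quadratic, `(ℓ)`
an inert rational prime, `λ ∋ ℓ`, a finite `p`-primary `T` with trivial `Γ_{K_λ}`-action killed by `q_λ − 1` and by
`#G_ℓ` (`G_ℓ = Gal(K[ℓ]/K[1])`; classically `#G_ℓ = (ℓ+1)/u_K`, so `(ℓ+1)·T = 0`, `p ∤ u_K` suffice), and every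
element of `G_ℓ` of order dividing `q_λ − 1` (`hGexp`): `IsCompl (H¹_f(K_λ, T)) (H¹_tr(K_λ, T))`.
[cite: Howard2004HeegnerKolyvagin, Prop. 1.1.9 and §1.2 (arXiv:1202.6340 p. 6 L17–25, L84–95)]
[cite: GrossLMS1991, §3] -/
theorem isCompl_unramifiedSubgroup_transverseCondition_of_isImaginaryQuadratic {M : Type} [AddCommGroup M]
    [TopologicalSpace M] [DiscreteTopology M] [Finite M] (p : ℕ) [Fact p.Prime] (hK : IsImaginaryQuadratic K)
    (ρ : DiscreteGaloisModule K M) (jbar : AlgebraicClosure K →+* ℂ) {ℓ : ℕ} (hℓ : ℓ.Prime)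
    (hℓP : (Ideal.span {(ℓ : 𝓞 K)}).IsPrime) {v : HeightOneSpectrum (𝓞 K)} (hv : (ℓ : 𝓞 K) ∈ v.asIdeal)
    (htriv : ∀ (g : absoluteGaloisGroup (v.adicCompletion K)) (x : M), GaloisRep.toLocal v ρ g x = x)
    (hp : ∀ x : M, ∃ n : ℕ, p ^ n • x = 0)
    (hq : ∀ x : M, (residueFieldCard (v.adicCompletion K) - 1) • x = 0)
    (hGexp : ∀ g ∈ ringClassGalOver (jbar.comp (algebraMap K (AlgebraicClosure K))) (ℓ * 1) 1,
      g ^ (residueFieldCard (v.adicCompletion K) - 1) = 1)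
    (hT : ∀ x : M,
      Nat.card (ringClassGalOver (jbar.comp (algebraMap K (AlgebraicClosure K))) (ℓ * 1) 1) • x = 0) :
    IsCompl (DiscreteGaloisModule.unramifiedSubgroup (GaloisRep.toLocal v ρ) 1)
      (transverseCondition p ρ ℓ jbar v) := by
  obtain ⟨σ₀, hσ₀⟩ := exists_isTameGenerator (F := v.adicCompletion K)
  haveI := localRingClassSubgroup_normal hK jbar hℓ.ne_zero v
  refine isCompl_unramifiedSubgroup_transverseCondition_of_cyclic p ρ ℓ jbar v htriv hp
    (isOpen_localRingClassSubgroup hK jbar hℓ.ne_zero v) hσ₀ hq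
    (exists_pow_inv_mul_mem_localRingClassSubgroup_of_isTameGenerator hK jbar hℓ hℓP hv hσ₀ hGexp)
    (fun d hd x => ?_)
  obtain ⟨k, hk⟩ := natCard_ringClassGalOver_dvd_of_pow_mem hK jbar hℓ hℓP hv hσ₀ hGexp hd
  rw [hk, mul_smul, hT]

end Literature.NumberTheory.GaloisCohomology.Howard2004

end
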